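import Literature.NumberTheory.Transcendental.SiegelStepCoefficients
import Literature.NumberTheory.Transcendental.EvaluationModuleProducts
import Literature.NumberTheory.Transcendental.ShidlovskyLemma
import Literature.NumberTheory.DiophantineApproximation.LeVequeInequality
import Mathlib.NumberTheory.SiegelsLemma
import Mathlib.Analysis.Matrix.Normed
import Mathlib.Tactic
import HarnessLib

/-!
# The Siegel step of CDT Lemma 61, II: the core construction

Calegari–Dimitrov–Tang, arXiv:2408.15403, §6.2 Lemma 61 / §6.3 (p. 50), with all asymptotic
choices left as explicit numeric hypotheses. Given power series `f_i = Σ a_{i,n}xⁿ/(A^{n+1}[1,…,Bn]^σ)`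
(`1 ≤ i ≤ m`) which are `ℚ[x]`-linearly independent and solve a linear differential system
`κ f′ = B_m f` (the supplemental hypothesis of Remark 39 under which Theorem 37 replaces
Theorem 40), there is `C = C(f)` (Shidlovsky) such that for all `d, D, L', L_small, ε` with
`mD + C < L'` and **fewer equations than unknowns**, where

* unknowns (`unknowns`): pairs `(𝐢, 𝐤)`, `𝐢 ∈ V` (a prescribed set of multi-indices; in CDT the
  balanced `V_m^d` of Lemma 60), `𝐤 ∈ {0,…,D−1}^d` with `D(𝐤/D) < ε` (eq. (6.8));
* equations (`equations`): exponents `𝐧 ∈ {0,…,L'−1}^d` with `max n_s ≤ L_small` or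
  `D(𝐧/L') ≥ ε` (the two vanishing families of §6.3),

Siegel's lemma (Mathlib's `Int.Matrix.exists_ne_zero_int_vec_norm_le`, Bombieri–Vaaler form of
the Thue–Siegel lemma) applied to the integer matrix `entry` of `SiegelStepCoefficients` yields
integers `c_{𝐢,𝐤}`, not all zero, with
`|c| ≤ (N · max(1, H))^{M/(N−M)}`, `H = ((C₁A)^{L'} [1,…,BL']^σ)^d`, such that
`F = Σ c_{𝐢,𝐤} 𝐱^𝐤 Π f_{i_s}(x_s) ≠ 0` has `β_𝐧(F) = 0` on both families, and hence — by
Shidlovsky's lemma in the form `Shidlovsky.shidlovsky_lowestOrder` (CDT Lemma 41, `ε = 0`) — the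
key property **(⋆)**: every minimal-order monomial `β_𝐧 𝐱^𝐧` of `F` has `𝐧 ∈ {0,…,L'−1}^d`,
`D(𝐧/L') < ε` and `max n_s > L_small` (`siegelStep_core`). The asymptotic bookkeeping of
Lemma 61 (`L' ≈ (m+δ)D`, `L_small ≈ (m−δ)D`, `N > M` from Theorem 45 on the grid and Lemma 60,
`|c| < e^{εdD}` for `d ≫ 1`, `D ≫ 1`) is not part of this file.

No named facts.

## References

* [CalegariDimitrovTang2024] arXiv:2408.15403, §6.2 eq. (6.8), Lemma 61, eq. (⋆); §6.3 (p. 50).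
-/

noncomputable section

open PowerSeries Finset
open Literature.NumberTheory.DiophantineApproximation

attribute [local instance] Matrix.seminormedAddCommGroup

namespace Literature.NumberTheory.Transcendental

namespace CalegariDimitrovTang

variable {m d : ℕ}

/-! ### Unknowns, equations, template -/

open Classical in
/-- The unknowns `c_{𝐢,𝐤}` of the auxiliary construction: `𝐢` in a prescribed set `V` of
multi-indices (in CDT: the balanced `V_m^d`, `Literature.Combinatorics.Enumerative.BalancedIndices`)
and `𝐤 ∈ {0,…,D−1}^d` with `D(𝐤/D) < ε`. [cite: CalegariDimitrovTang2024, §6.2 eq. (6.8)] -/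
def unknowns (V : Finset (Fin d → Fin m)) (D : ℕ) (ε : ℝ) :
    Finset ((Fin d → Fin m) × (Fin d → Fin D)) :=
  univ.filter fun ik => ik.1 ∈ V ∧
    Discrepancy.boxDiscrepancy (fun s => (((ik.2 s : ℕ)) : ℝ) / D) < ε

open Classical in
/-- The equations `β_𝐧 = 0` of the auxiliary construction: `𝐧 ∈ {0,…,L'−1}^d` with
`max_s n_s ≤ L_small` or `D(𝐧/L') ≥ ε`. [cite: CalegariDimitrovTang2024, §6.3 (p. 50)] -/
def equations (d L' Lsmall : ℕ) (ε : ℝ) : Finset (Fin d → Fin L') :=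
  univ.filter fun n => (∀ s, ((n s : ℕ)) ≤ Lsmall) ∨
    ε ≤ Discrepancy.boxDiscrepancy (fun s => (((n s : ℕ)) : ℝ) / L')

/-- The auxiliary function template `F(𝐱) = Σ_{𝐢,𝐤} c_{𝐢,𝐤} 𝐱^𝐤 Π_s f_{i_s}(x_s)`.
[cite: CalegariDimitrovTang2024, §6.2 eq. (6.8)] -/
def template (f : Fin m → ℚ⟦X⟧) {D : ℕ} (c : (Fin d → Fin m) × (Fin d → Fin D) → ℤ) :
    MvPowerSeries (Fin d) ℚ :=
  ∑ ik, (c ik : ℚ) • tprod fun s => (X : ℚ⟦X⟧) ^ ((ik.2 s : ℕ)) * f (ik.1 s)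

/-- The template lies in the `d`-th Cartesian power of the evaluation module `E_D`.
[cite: CalegariDimitrovTang2024, §3.1.3] -/
theorem template_mem_prodModule (f : Fin m → ℚ⟦X⟧) {D : ℕ}
    (c : (Fin d → Fin m) × (Fin d → Fin D) → ℤ) :
    template f c ∈ prodModule (evalModule f D) d := by
  unfold template
  refine Submodule.sum_mem _ fun ik _ => Submodule.smul_mem _ _ ?_
  exact tprod_mem_prodModule_evalModule f D ik.1 (fun s => (ik.2 s : ℕ)) fun s => (ik.2 s).isLt

/-- The template is non-zero as soon as some coefficient is (independence of the products,
`linearIndependent_tprod_X_pow_mul`). [cite: CalegariDimitrovTang2024, §6.3 (p. 50)] -/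
theorem template_ne_zero (f : Fin m → ℚ⟦X⟧) (hf : LinearIndependent (Polynomial ℚ) f) {D : ℕ}
    {c : (Fin d → Fin m) × (Fin d → Fin D) → ℤ} (hc : c ≠ 0) : template f c ≠ 0 := by
  classical
  -- reindex by `Fin d → Fin m × Fin D`
  let e : ((Fin d → Fin m) × (Fin d → Fin D)) ≃ (Fin d → Fin m × Fin D) :=
    { toFun := fun ik s => (ik.1 s, ik.2 s)
      invFun := fun κ => (fun s => (κ s).1, fun s => (κ s).2)
      left_inv := fun ik => by rfl
      right_inv := fun κ => by funext s; rfl }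
  have hli := (linearIndependent_tprod_X_pow_mul f hf D d).comp e e.injective
  have hli' : LinearIndependent ℚ (fun ik : (Fin d → Fin m) × (Fin d → Fin D) =>
      tprod fun s => (X : ℚ⟦X⟧) ^ ((ik.2 s : ℕ)) * f (ik.1 s)) := by
    rw [show ((fun κ : Fin d → Fin m × Fin D => tprod fun s => (X : ℚ⟦X⟧) ^ (((κ s).2 : ℕ)) * f (κ s).1) ∘ ⇑e) =
      (fun ik : (Fin d → Fin m) × (Fin d → Fin D) => tprod fun s => (X : ℚ⟦X⟧) ^ ((ik.2 s : ℕ)) * f (ik.1 s))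
      from rfl] at hli
    exact hli
  intro h0
  apply hc
  funext ik
  have := Fintype.linearIndependent_iff.mp hli' (fun ik => (c ik : ℚ)) (by
    unfold template at h0; exact h0) ik
  exact_mod_cast this

/-! ### The core of Lemma 61 -/

/-- **The Siegel step (core of CDT Lemma 61).** See the module docstring.
[cite: CalegariDimitrovTang2024, §6.2 Lemma 61 and eq. (⋆); §6.3 (p. 50)] -/
theorem siegelStep_core {A B σ C₁ : ℕ} (hA : 0 < A) (hC₁ : 0 < C₁)
    (a : Fin m → ℕ → ℤ) (ha : ∀ i n, |a i n| ≤ (C₁ : ℤ) ^ (n + 1))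
    {κ : Polynomial ℚ} (hκ : κ ≠ 0) {Bm : Matrix (Fin m) (Fin m) (Polynomial ℚ)}
    (hsol : Shidlovsky.IsSol Shidlovsky.incl κ Bm (fun i => crudeSeries A B σ (a i)))
    (hind : LinearIndependent (Polynomial ℚ) (fun i => crudeSeries A B σ (a i))) :
    ∃ C : ℕ, ∀ (d D L' Lsmall : ℕ) (V : Finset (Fin d → Fin m)) (ε : ℝ), m * D + C < L' →
      (equations d L' Lsmall ε).card < (unknowns V D ε).card →
      ∃ c : (Fin d → Fin m) × (Fin d → Fin D) → ℤ, c ≠ 0 ∧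
        (∀ ik, ik ∉ unknowns V D ε → c ik = 0) ∧
        (∀ ik, (|c ik| : ℝ) ≤ ((unknowns V D ε).card *
            max 1 ((((C₁ * A) ^ L' * Nat.lcmUpto (B * L') ^ σ : ℕ) : ℝ) ^ d)) ^
              (((equations d L' Lsmall ε).card : ℝ) /
                ((unknowns V D ε).card - (equations d L' Lsmall ε).card))) ∧
        template (fun i => crudeSeries A B σ (a i)) c ≠ 0 ∧
        (∀ n ∈ equations d L' Lsmall ε,
          MvPowerSeries.coeff (Finsupp.equivFunOnFinite.symm fun s => ((n s : ℕ)))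
            (template (fun i => crudeSeries A B σ (a i)) c) = 0) ∧
        (∀ n : Fin d →₀ ℕ, MvPowerSeries.coeff n (template (fun i => crudeSeries A B σ (a i)) c) ≠ 0 →
          (∀ n' : Fin d →₀ ℕ, MvPowerSeries.coeff n' (template (fun i => crudeSeries A B σ (a i)) c) ≠ 0 →
            n.degree ≤ n'.degree) →
          (∀ s, n s < L') ∧ Discrepancy.boxDiscrepancy (fun s => (n s : ℝ) / L') < ε ∧
            ∃ s, Lsmall < n s) := by
  classical
  set f : Fin m → ℚ⟦X⟧ := fun i => crudeSeries A B σ (a i) with hf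
  obtain ⟨C, hC⟩ := Shidlovsky.shidlovsky_lowestOrder hκ hsol hind
  refine ⟨C, fun d D L' Lsmall V ε hL hMN => ?_⟩
  set U := unknowns V D ε with hU
  set E := equations d L' Lsmall ε with hE
  -- the integer matrix
  set Amat : Matrix E U ℤ := fun n ik =>
    entry A B σ a ik.1.1 (fun s => ((ik.1.2 s : ℕ))) (fun s => ((n.1 s : ℕ))) with hAmat
  set H : ℝ := (((C₁ * A) ^ L' * Nat.lcmUpto (B * L') ^ σ : ℕ) : ℝ) ^ d with hH
  have hL1 : 1 ≤ L' := by omega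
  have hentry : ∀ (n : E) (ik : U), (|Amat n ik| : ℝ) ≤ H := by
    intro n ik
    have h := abs_entry_le (d := d) hA hC₁ B σ ha ik.1.1 (fun s => ((ik.1.2 s : ℕ)))
      (fun s => ((n.1 s : ℕ))) (L := L' - 1) (fun s => by have := (n.1 s).isLt; omega)
    rw [Nat.sub_add_cancel hL1] at h
    have h' : (|Amat n ik| : ℝ) ≤ (((((C₁ * A) ^ L' * Nat.lcmUpto (B * (L' - 1)) ^ σ : ℕ) : ℤ)) ^ d : ℤ) := by
      exact_mod_cast h
    refine h'.trans ?_
    rw [hH]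
    push_cast
    gcongr
    · exact_mod_cast Literature.NumberTheory.LFunctions.lcmUpto_le_lcmUpto_of_le (Nat.mul_le_mul_left B (Nat.sub_le L' 1))
  have hH0 : 0 ≤ H := by positivity
  have hnormA : ‖Amat‖ ≤ H := by
    rw [Matrix.norm_le_iff hH0]
    intro n ik
    rw [Int.norm_eq_abs]
    exact_mod_cast hentry n ik
  -- cardinalities
  have hcardU : Fintype.card U = U.card := Fintype.card_coe U
  have hcardE : Fintype.card E = E.card := Fintype.card_coe E
  have hUpos : 0 < U.card := by omega
  -- a non-zero integer vector with small height annihilated by `Amat`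
  have hvec : ∃ t : U → ℤ, t ≠ 0 ∧ Amat.mulVec t = 0 ∧
      ∀ u, (|t u| : ℝ) ≤ (U.card * max 1 H) ^ ((E.card : ℝ) / (U.card - E.card)) := by
    rcases Nat.eq_zero_or_pos E.card with hE0 | hEpos
    · -- no equations: any unit vector
      obtain ⟨u₀⟩ : Nonempty U := by
        rw [← Fintype.card_pos_iff, hcardU]; exact hUpos
      refine ⟨Pi.single u₀ 1, ?_, ?_, fun u => ?_⟩
      · intro h; have := congrFun h u₀; simp at this
      · funext n; exfalso
        have : 0 < E.card := by rw [← hcardE]; exact Fintype.card_pos_iff.mpr ⟨n⟩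
        omega
      · rw [hE0, Nat.cast_zero, zero_div, Real.rpow_zero]
        by_cases hu : u = u₀
        · subst hu; simp
        · simp [Pi.single_eq_of_ne hu]
    · obtain ⟨t, ht0, hAt, hnorm⟩ := Int.Matrix.exists_ne_zero_int_vec_norm_le Amat
        (by rw [hcardU, hcardE]; exact hMN) (by rw [hcardE]; exact hEpos)
      refine ⟨t, ht0, hAt, fun u => ?_⟩
      have h1 : (|t u| : ℝ) ≤ ‖t‖ := by
        have := norm_le_pi_norm t u
        rw [Int.norm_eq_abs] at this
        exact_mod_cast this
      refine h1.trans (hnorm.trans ?_)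
      rw [hcardU, hcardE]
      have hexp : 0 ≤ (E.card : ℝ) / (U.card - E.card) := by
        apply div_nonneg (Nat.cast_nonneg _)
        have : (E.card : ℝ) < U.card := by exact_mod_cast hMN
        linarith
      exact Real.rpow_le_rpow (by positivity) (by gcongr) hexp
  obtain ⟨t, ht0, hAt, htle⟩ := hvec
  -- extend by zero
  set c : (Fin d → Fin m) × (Fin d → Fin D) → ℤ := fun ik => if h : ik ∈ U then t ⟨ik, h⟩ else 0 with hc
  have hcU : ∀ ik (h : ik ∈ U), c ik = t ⟨ik, h⟩ := fun ik h => by simp [hc, h]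
  have hcout : ∀ ik, ik ∉ U → c ik = 0 := fun ik h => by simp [hc, h]
  have hc0 : c ≠ 0 := by
    intro h0
    apply ht0
    funext u
    have := congrFun h0 u.1
    rw [hcU u.1 u.2] at this
    simpa using this
  -- vanishing of `β_n` for `n ∈ E`
  have hvanish : ∀ n ∈ E, MvPowerSeries.coeff (Finsupp.equivFunOnFinite.symm fun s => ((n s : ℕ)))
      (template f c) = 0 := by
    intro n hn
    unfold template
    rw [coeff_sum_eq_zero_iff hA B σ a (fun ik : (Fin d → Fin m) × (Fin d → Fin D) => ik.1)
      (fun ik s => ((ik.2 s : ℕ))) c]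
    -- the sum is `(Amat *ᵥ t) n = 0`
    have h1 : ∑ ik, c ik * entry A B σ a ik.1 (fun s => ((ik.2 s : ℕ)))
        (Finsupp.equivFunOnFinite.symm fun s => ((n s : ℕ))) =
        ∑ ik ∈ U, c ik * entry A B σ a ik.1 (fun s => ((ik.2 s : ℕ))) (fun s => ((n s : ℕ))) := by
      rw [← Finset.sum_subset (Finset.subset_univ U)]
      · rfl
      · intro ik _ hik; rw [hcout ik hik, zero_mul]
    rw [h1, ← Finset.sum_coe_sort U]
    have h2 := congrFun hAt ⟨n, hn⟩
    simp only [Matrix.mulVec, dotProduct, Pi.zero_apply, hAmat] at h2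
    rw [← h2]
    refine Finset.sum_congr rfl fun u _ => ?_
    rw [hcU u.1 u.2, mul_comm]
  refine ⟨c, hc0, hcout, fun ik => ?_, template_ne_zero f hind hc0, hvanish, fun n hn hmin => ?_⟩
  · -- height
    by_cases hik : ik ∈ U
    · rw [hcU ik hik]; exact htle ⟨ik, hik⟩
    · rw [hcout ik hik, Int.cast_zero, abs_zero]
      positivity
  · -- (⋆)
    have hbox : ∀ s, n s ≤ m * D + C := hC d D (template f c) (template_mem_prodModule f c) n hn hmin
    have hlt : ∀ s, n s < L' := fun s => lt_of_le_of_lt (hbox s) hL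
    set n' : Fin d → Fin L' := fun s => ⟨n s, hlt s⟩ with hn'
    have hnn' : (Finsupp.equivFunOnFinite.symm fun s => ((n' s : ℕ))) = n := by
      ext s; rfl
    have hnotin : n' ∉ E := by
      intro hin
      have := hvanish n' hin
      rw [hnn'] at this
      exact hn this
    rw [hE, equations, Finset.mem_filter, not_and_or] at hnotin
    rcases hnotin with h | h
    · exact absurd (Finset.mem_univ _) h
    · push Not at h
      obtain ⟨⟨s, hs⟩, hdisc⟩ := h
      refine ⟨hlt, ?_, ⟨s, by exact_mod_cast hs⟩⟩
      convert hdisc using 2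

end CalegariDimitrovTang

end Literature.NumberTheory.Transcendental
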